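import Literature.Barriers.CriticalPhenomena.LongRangeTrivialityOnZ3LocalityAudit
import Literature.Barriers.CriticalPhenomena.LongRangeTrivialityOnZ3SusceptibilityAudit
import Mathlib.NumberTheory.Harmonic.Bounds
import HarnessLib

/-!
# Audit (D-0021, generation 8) of `LongRangeTrivialityOnZ3Proofs.lean`: the MARGINAL line — on `ℤ³`
# the profile `⟨σ₀σ_x⟩_{β_c} ≍ |x|^{-3/2}` (`χ_n ≍ n^{3/2}`, `B_n ≍ log n`) saturates every printed
# nearest-neighbour two-point theorem and is the `d_eff = 4` scenario of the IMPROVED tree diagram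
# bound; the two-point input separating `J_nn` from all Gaussian mechanisms is the STRICT `η < 1/2`

Barrier catalogue `Literature/Barriers/CriticalPhenomena/` (D-0021), sub-problem `Ising3DConformalLimit`.
Eighth audit record (refuter, barrier-audit mode, generation 8, 2026-08-15) for the sibling
`LongRangeTrivialityOnZ3Proofs.lean` (discharge of `panis_variance_bound`) of the barrier
`LongRangeTrivialityOnZ3`, after generations 1–7 (`…ProofsAudit` gen 1 & 6, `…BubbleAudit`,
`…PointwiseAudit`, `…SusceptibilityAudit` + `…DCPLowerBound`, `…LocalityAudit`, `…PerturbativeAudit`).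
A separate leaf file is used, as before, so that the modules importing `…Proofs` are not rebuilt.
Everything below is PROVED; no definition and no named fact is introduced (D-0026).

## Verdict: discharge and trust base CONFIRMED; the parent block's `evasions_known` NARROWED at one
## sentence (generation 4's "the two-point input a nearest-neighbour proof must consume exists at
## exactly the required strength") and generation 5's window "`0 < η ≤ 1/2`" at its endpoint

### A. Trust base (re-checked after the 2026-08-14 renames, `lean check --axioms`, 2026-08-15)

`panis_variance_bound_holds ∧ LongRangeTrivialityOnZ3_holds ∧ PerturbativeTrivialityOnZ3_holds` closes on
`propext`, `Classical.choice`, `Quot.sound` only (probe file of this audit). `LongRangeTrivialityOnZ3Proofs.lean`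
contains theorems only; its discharge is faithful (generation 1 §A) and is an input of
`BubbleTrivialityOnZ3_holds` / `SusceptibilityTrivialityOnZ3_holds`, through which §D below runs.

### B. The marginal line (what the sources print, page level, read for this audit)

* THE COUNT. "`|U₄(x₁,…,x₄)|/S₄(x₁,…,x₄) ≤ C L^d/L^{2(d-2+η)} = C/L^{d-4+2η}`" [cite: AizenmanCDM2020, §10.1 eqs. (10.1)–(10.2), p. 31]:
  on `ℤ³` the exponent `d - 4 + 2η` vanishes at `η = 1/2` — the analogue of `η = 0` on `ℤ⁴`. The `ℤ⁴`
  dichotomy "`κ := lim S₂(0,x)‖x‖²`: if `κ = 0` the original tree diagram bound … tends to zero; if `κ > 0`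
  the bubble diagram diverges, (10.7) holds, and the scaling limit is gaussian"
  [cite: AizenmanCDM2020, §10.3 (pp. 33–34), with (10.6)–(10.7), p. 33] reads on `ℤ³` with `‖x‖^{3/2}`:
  `κ₃ = 0` is generation 4's `χ_L(β_c) = o(L^{3/2})` (plain bound, PROVED: `SusceptibilityTrivialityOnZ3_holds`);
  `0 < κ₃ < ∞` is the MARGINAL line (`B_L ≍ log L → ∞`, improved bound); only `κ₃ = ∞` — decay SLOWER than
  `|x|^{-3/2}`, "`η < 1/2`" strictly — is left for non-triviality. "Note that if `η > 0` for `d = 4`, then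
  `B_L(β_c)` is bounded uniformly in `L` in which case the tree diagram bound implies the improved one. Thus
  … the case requiring attention is just `η = 0`" [cite: AizenmanDuminilCopinAnnals2021, §4 (after Assumption 4.1), p. 10] —
  on `ℤ³`: `η > 1/2` bounded bubble (generation 2), `η = 1/2` the case requiring the improved bound.
* THE IMPROVED BOUND ON `ℤ³` IS PRINTED FOR THE COUPLING `α = 3/2` ONLY, AND ITS AUTHOR EXPECTS MORE.
  Theorem 1.9 / Corollary 1.11 (`1 ≤ d ≤ 3`, `J_{x,y} = C₀|x-y|₁^{-3d/2}`: `|U₄^{β_c}| ≤ (C/ψ(B_L(β_c)))·tree`,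
  `ψ(t) → ∞`; `lim_{β↗β_c} g_σ(β) = 0`; "for `β = β_c`, every sub-sequential scaling limit of the model is
  Gaussian"), "More general versions of the following statements can be found in Section 7"
  [cite: Panis2023Triviality, Theorem 1.9, Remark 1.10 and Corollary 1.11, p. 8]; Theorem 7.1 / Corollary 7.3
  assume (A1)–(A5) and the two-sided COUPLING bound `𝐜/|x|^{d+α(d)} ≤ J_{0,x} ≤ 𝐂/|x|^{d+α(d)}`, `α(d) = d/2`,
  with the footnote "This assumption is a little more restrictive than before since we now require some
  regularity property on the interaction. This restriction is essentially technical and we believe that the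
  proof which follows should hold under more general assumptions", and Remark 7.2 (the `B_L^c` gain would
  follow from `χ_N/N^{γ(3)} ≤ Cχ_n/n^{γ(3)}`, `γ(3) = 3/2`); "If `B(β_c) = ∞`, one has `φ_{β_c}(t) → ∞`"
  [cite: Panis2023Triviality, §7 (Assumption, footnote 7, Theorem 7.1, Remark 7.2, Corollary 7.3), p. 34].
  The inputs of §7 are: the infrared UPPER bound `(IRB_α)` `⟨σ₀σ_x⟩_β ≤ 𝐂₂/(β_c|x|^{d-α∧2})` (on `ℤ³`,
  `α = 3/2`: the marginal decay `|x|^{-3/2}`), the WEAK lower bound `(LB_α)` `⟨σ₀σ_x⟩_β ≥ 𝐂₃/(β|x|^{d-1})`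
  below the sharp length (Proposition 3.23-type, `|x|^{-2}` on `ℤ³` — not the matching one), weak regular
  scales from the sliding-scale infrared bound, and no-jump / no-zigzag lemmas (Lemma 7.6, Corollary 7.8)
  whose only use of the coupling is its TAIL `J_{u,v} ≲ |u-v|^{-d-α}` — vacuous for a finite-range `J`
  [cite: Panis2023Triviality, §7 ((IRB_α), (LB_α), p. 34; Proposition 7.5, Lemma 7.6, Corollary 7.8, pp. 34–36)].
  The STRICT side is printed for general (A1)–(A5) interactions, the nearest-neighbour one included:
  Theorem 5.5 under the two-point hypothesis (5.1) `⟨σ₀σ_x⟩_{β_c} ≤ 𝐂/|x|^{d-2+η}`, `d + 2η > 4`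
  [cite: Panis2023Triviality, Theorem 5.5 and Remark 5.4, p. 21] (generation 4 proved the sharper
  `χ_L = o(L^{3/2})` form). The marginal `d + 2η = 4` for a general (A1)–(A5) `J` — in particular for `J_nn`
  on `ℤ³` under the HYPOTHESIS `⟨σ₀σ_x⟩_{β_c} = O(|x|^{-3/2})` — is NOT printed; by the footnote and the
  list of inputs (all available for the reflection-positive nearest-neighbour model: sliding-scale infrared
  bound, MMS, Proposition 3.23 since `𝔪₂(J_nn) < ∞`, the mixing "has an extension to three dimensions using
  [ADS15], but there it becomes non-quantitative" [cite: AizenmanDuminilCopinAnnals2021, §6 (Discussion after Theorem 6.4), p. 22],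
  and `B(β_c) = ∞` [cite: DuminilCopinPanis2025LowerBounds, Theorem 1.8]) it is the expected extension,
  and is treated below as a CONJECTURAL blocked class, never as a fact.
* THE NEAREST-NEIGHBOUR TWO-POINT THEOREMS ON `ℤ³` ARE ALL SATURATED BY THE MARGINAL PROFILE
  `⟨σ₀σ_x⟩ ≍ |x|^{-3/2}`: the infrared bound `C/|x|^{d-2}` and Simon's `c/|x|^{d-1}` ("These two results
  show that (if it exists) the critical exponent `η` satisfies `0 ≤ η ≤ 1` … When `d = 3`, the results are
  confined to the bounds `0 ≤ η ≤ 1`. … We also obtain a new bound on `η` when `d = 3`: if it exists,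
  `η ≤ 1/2`") [cite: DuminilCopinPanis2025LowerBounds, §1 (the infrared bound, Simon's lower bound and the following paragraphs), p. 4];
  Theorem 1.3, `⟨τ₀τ_{ne₁}⟩_β ≥ c₁/(χ_{4n}(β) + n^{d-2}∑_{k≤2n}k⟨τ₀τ_{ke₁}⟩_β)` — with `⟨τ₀τ_x⟩ ≍ |x|^{-3/2}`
  both terms of the denominator are `≍ n^{3/2}` and the conclusion is `≥ c n^{-3/2}`, the profile itself
  (§D: `LongRangeIsing.marginalProfile_of_dcp`) [cite: DuminilCopinPanis2025LowerBounds, Theorem 1.3, p. 5];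
  Theorem 1.5 (`η ≤ 1/2`, equality allowed) [cite: DuminilCopinPanis2025LowerBounds, Theorem 1.5, p. 6];
  the proof of Theorem 1.8 (under `B(β_c) < ∞` it derives `⟨τ₀τ_{(n/4)e₁}⟩_{β_c} ≥ c₃/n^{3/2}`, contradicting
  finiteness — a LOGARITHMIC divergence is all it yields) and Remark 1.9, `B_n(β_c) ≥ c√(log n)` for `d = 3`,
  against `B_n ≍ log n` for the marginal profile (§D: `bubble_le_log_of_marginalDecay`)
  [cite: DuminilCopinPanis2025LowerBounds, proof of Theorem 1.8 and Remark 1.9, p. 7].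
  Status of the four-point question in 2025, in the words of the method's author: the multi-spin
  correlations at the critical state are "Gaussian in high dimensions, definitely not in `d = 2`, and likely
  not in `d = 3`" [cite: Aizenman2025, §4.2 (p. 7)].

### C. Consequence for the parent block (text; proposed separately as a docstring amendment)

Generation 4's sentence in `evasions_known` — "so the two-point input a nearest-neighbour proof must
consume exists at exactly the required strength" — is exact for the PLAIN tree-diagram mechanism
(`SusceptibilityTrivialityOnZ3`, whose reach `χ_L(β_c) = o(L^{3/2})` the nearest-neighbour model leaves by
Theorem 1.3), and its own caveat (c) records that improved tree diagram bounds are "a different mechanism,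
not blocked and not covered". Read together with §B: against the IMPROVED mechanism the required two-point
input is the STRICT inequality — `limsup_x |x|^{3/2}⟨σ₀σ_x⟩_{β_c} = ∞`, equivalently (MMS) `χ_L(β_c)/L^{3/2}`
unbounded, or in window form "`⟨σ₀σ_{ne₁}⟩ ≥ c(n/m)^{-(3/2-ε)}⟨σ₀σ_{me₁}⟩`, `ε > 0`" — and it does NOT exist in
print: every printed nearest-neighbour bound is met by the marginal profile, for which the improved bound is
PROVED Gaussian inside the barrier's own family (`α = 3/2`, Corollary 1.11; not part of the formal barrier,
caveat (c) of the parent) and conjectured Gaussian in general (footnote 7). So generation 5's window for the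
nearest-neighbour two-point function should read "`0 < η < 1/2`; `η = 1/2` is the marginal,
`ℤ⁴`-like line (Gaussian with logarithmic corrections, conjecturally)", and the nearest-neighbour-specific
two-point input a proof of clause (iii) must consume is one notch BEYOND Duminil-Copin–Panis 2025 (an `n^ε`,
or at least a `B_n/log n → ∞`, improvement of Theorem 1.3 / Remark 1.9). The planners' lines already consume
exactly this: item `WindowBelowHalf` (`ε > 0`) of route `LatticeSDPCertificates` (grounded "STRONGER than
print" against `Literature.Probability.LatticeModels.dcp_isingEta_le_half`) and crux (1) "TopHeavyBubble =
beat DC–Panis by `n^ε`" of card `top-heavy-bubble-nontriviality`; this audit records on the BARRIER side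
that the strictness is not a convenience of those lines but (modulo footnote 7) a necessity for every line.
Nothing in the formal content of any generation changes.

### D. What is proved here (all theorems; no definition, no named fact)

Namespace `LongRangeIsing`, `J ≥ 0` on `ℤ³`, `β_c = LongRangeIsing.criticalBeta J`, decay hypotheses in
generation 5's form `HasCriticalDecay J θ` (`⟨σ₀σ_x⟩_{β_c} ≤ C/‖x‖^θ`, sup norm):

* `HasCriticalDecay.of_le` (monotonicity in `θ`); `hasCriticalDecay_threeHalves_of_le` — EVERY member
  `C₀|x-y|₁^{-3-α}` with `α ≤ 3/2` has marginal-or-faster critical decay (the tree's infrared bound,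
  `hasCriticalDecay_algebraic`), the member `α = 3/2` realising `θ = 3/2` exactly: the barrier's family
  contains the marginal witness (Gaussian by Corollary 1.11 — cited, not vendored).
* `not_hasNonGaussianSmearingZ3_of_decay_gt` — the STRICT half of the marginal principle is a theorem of the
  tree for every MMS-monotone translation-invariant `J ≥ 0`: `θ > 3/2` ⟹ `B(β_c) < ∞` ⟹ Gaussian
  (generations 2 and 5 combined).
* `boxSusceptibility_le_of_marginalDecay`, `boxSusceptibility_sq_div_cube_le_of_marginalDecay` — under
  `θ = 3/2`: `χ_L(β_c) ≤ CL^{3/2}` and `χ_L(β_c)²/L³ ≤ C'`: BOUNDED, i.e. exactly on the boundary of the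
  generation-4 class (`→ 0` is its hypothesis; `≥ c` infinitely often is its necessary condition for
  non-Gaussianity) — neither side decides the marginal line.
* `bubble_le_log_of_marginalDecay` — `∑_{x∈Λ_n}⟨σ₀σ_x⟩²_{β_c} ≤ C(1 + log n)`: the marginal profile is
  compatible with `B(β_c) = ∞` and with Remark 1.9's `B_n ≥ c√(log n)`.
* `dcpDenominator_le_of_marginalDecay`, `marginalProfile_of_dcp` — under `θ = 3/2` the denominator of
  Theorem 1.3 is `≤ Dn^{3/2}`, so Theorem 1.3's inequality (taken as a hypothesis at `β_c` in the shape of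
  `frequently_boxSusceptibility_sq_ge_of_dcp`, generation 4) RETURNS the two-sided marginal axial profile
  `c/n^{3/2} ≤ ⟨σ₀σ_{ne₁}⟩_{β_c} ≤ C/n^{3/2}`: the Duminil-Copin–Panis inequality has the marginal profile as
  a fixed point and cannot exclude it.

Outside the namespace: `not_hasCriticalDecay_threeHalves_of_marginalPrinciple` — the skeleton of §C: IF
the marginal principle holds on `ℤ³` ("MMS-monotone translation-invariant `J ≥ 0` with
`⟨σ₀σ_x⟩_{β_c} = O(|x|^{-3/2})` has Gaussian critical smearings"; an inline hypothesis, footnote 7's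
conjecture, NOT a fact of the tree), then a non-Gaussian critical smearing of any member of `Z3Model` — the
nearest-neighbour model included — forces the FAILURE of marginal decay, `¬ HasCriticalDecay J (3/2)`, i.e.
`η < 1/2` in the strict, lim-sup sense; `interactionUniformZ3_marginalPrinciple_strict` — the strict half
IS interaction-uniform on `Z3Model` (MMS2 granted), like generations 2 and 4.

### E. Literature (evasion search, generation 8)

Held and read at page level for this audit: Panis 2023 (pp. 8, 21, 34–36), Aizenman–Duminil-Copin 2021
(pp. 9–10, 22), Aizenman CDM 2020 (pp. 31–33), Duminil-Copin–Panis 2025 (pp. 3–7), Aizenman 2025 Part III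
(arXiv:2509.02850: abstract, §1, §4.2 p. 7, §11 p. 24 — frustration/disorder operators, `ℤ₂` gauge duality in
`d = 3`, GHS; no `d = 3` four-point lower bound), the FK-Ising incipient-infinite-cluster paper for `d ≥ 3`
(arXiv:2406.15243, §1: mixing and IIC, `d > 4` susceptibility constant; no bound on `η`),
Duminil-Copin–Markar–Panis–Slade 2026 (arXiv:2605.21438: `d > d_c` only), Duminil-Copin's ICM survey (§8.4).
Searches: arXiv ≥ 2024 "Ising two-point function lower bound" (5; DCP only relevant), ≥ 2025 "random current
Ising three dimensions critical" (1: Aizenman Part III); `lit citing arxiv:2404.05700` (7 works, none improving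
`η ≤ 1/2`); `lit galaxy search --star pdf --mode bm25` on the marginal/`η = 1/2` question (25 physics hits,
nothing rigorous); `lit search --hybrid` ran with the FTS leg skipped (index busy) and `lit related` failed
(graphd connection reset) — recorded as search-degraded in NOTES; no grade depends on them. No published
argument proves `η < 1/2` (strictly) or non-Gaussianity for any ferromagnet on `ℤ³`.

## References

* R. Panis, arXiv:2309.05797 (2023) = Ann. Probab. 54 (2026): Theorem 1.9, Remark 1.10, Corollary 1.11
  (p. 8); Theorem 5.5, Remark 5.4 (p. 21); §7: Assumption, footnote 7, Theorem 7.1, Remark 7.2, Corollary 7.3,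
  (IRB_α), (LB_α) (p. 34), Proposition 7.5, Lemma 7.6, Corollary 7.8 (pp. 34–36) [Panis2023Triviality] (held; read).
* M. Aizenman, H. Duminil-Copin, Ann. Math. 194 (2021), arXiv:1912.07973: §4 Assumption 4.1 and the remark
  following it (p. 10); §6, Discussion (p. 22); §1.3 (p. 9) [AizenmanDuminilCopinAnnals2021] (held; read).
* M. Aizenman, Current Developments in Mathematics 2020, arXiv:2112.04248: §10.1 (10.1)–(10.2) (p. 31),
  §10.2 (10.4)–(10.7) (pp. 32–33), §10.3 (p. 33) [AizenmanCDM2020] (read).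
* H. Duminil-Copin, R. Panis, Commun. Math. Phys. 406 (2025), arXiv:2404.05700: §1 (p. 4), Theorem 1.3 (p. 5),
  Theorem 1.5 (p. 6), Theorem 1.8 with proof and Remark 1.9 (pp. 6–7) [DuminilCopinPanis2025LowerBounds] (held; read).
* M. Aizenman, *Geometric analysis of Ising models, Part III*, Math. Phys. Anal. Geom. 28 (2025) 32,
  arXiv:2509.02850: §4.2 (p. 7), §11 (p. 24) [Aizenman2025] (held; read).
* Tree: `Literature.Probability.LatticeModels.dcp_isingEta_le_half` (`CriticalEtaUpperDCP.lean`), route item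
  `Summit.CriticalPhenomena.Ising3DConformalLimit.Theses.LatticeSDPCertificates.WindowBelowHalf`, card
  `Summits/CriticalPhenomena/Ising3DConformalLimit/Ideas/top-heavy-bubble-nontriviality.md`.

## Tree anchors

`HasCriticalDecay`, `hasCriticalDecay_algebraic`, `summable_sq_pairCorrelation_of_decay` (`…LocalityAudit`);
`BubbleTrivialityOnZ3_holds`, `Z3Model.coupling_nonneg/_add` (`…BubbleAudit`); `boxSusceptibility_le_of_irb`
(`…UrsellSum`); `sum_box_sdiff_eq_sum_sphere`, `card_sphere_three_le`, `sum_Icc_rpow_neg_le` (`…LatticeSums`);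
`pairCorrelation_nonneg`, `abs_pairCorrelation_le_one` (`…TwoPoint`); `criticalBeta_nonneg` (`…Proofs`);
`Site.supNorm`, `Site.norm_eq_supNorm`, `Site.supNorm_le_iff`, `Site.natAbs_le_supNorm`,
`Site.supNorm_eq_zero_iff`, `mem_box_iff_supNorm_le`, `box_mono`, `card_box`; Mathlib `harmonic_eq_sum_Icc`,
`harmonic_le_one_add_log`, `Real.rpow_le_rpow_of_exponent_le`, `Real.one_le_rpow`, `Real.mul_rpow`.
-/

noncomputable section

namespace Literature.Barriers.CriticalPhenomena

open Literature.Probability.LatticeModels Literature.Probability.Percolation Filter Topology Finset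

namespace LongRangeIsing

/-! ### 1. Decay exponents: monotonicity; the marginal witness inside the family -/

/-- `HasCriticalDecay J θ` is monotone in `θ`: decay `‖x‖^{-θ}` implies decay `‖x‖^{-θ'}` for
`θ' ≤ θ` (`‖x‖ ≥ 1` for `x ≠ 0` in the sup norm). [folklore] -/
theorem HasCriticalDecay.of_le {J : Site 3 → Site 3 → ℝ} {θ θ' : ℝ} (h : HasCriticalDecay J θ)
    (hle : θ' ≤ θ) : HasCriticalDecay J θ' := by
  obtain ⟨C, hC⟩ := h
  refine ⟨max C 0, fun x hx => ?_⟩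
  have hn : ‖x‖ = (Site.supNorm x : ℝ) := Site.norm_eq_supNorm x
  have h1 : (1 : ℝ) ≤ ‖x‖ := by
    rw [hn]
    have h' : Site.supNorm x ≠ 0 := fun h0 => hx (Site.supNorm_eq_zero_iff.1 h0)
    exact_mod_cast Nat.one_le_iff_ne_zero.2 h'
  have hpos : 0 < ‖x‖ ^ θ := Real.rpow_pos_of_pos (by linarith) _
  have hpos' : 0 < ‖x‖ ^ θ' := Real.rpow_pos_of_pos (by linarith) _
  calc pairCorrelation J (LongRangeIsing.criticalBeta J) 0 x ≤ C / ‖x‖ ^ θ := hC x hx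
    _ ≤ max C 0 / ‖x‖ ^ θ := by gcongr; exact le_max_left _ _
    _ ≤ max C 0 / ‖x‖ ^ θ' :=
        div_le_div_of_nonneg_left (le_max_right _ _) hpos'
          (Real.rpow_le_rpow_of_exponent_le h1 hle)

/-- **The marginal witness is in the family**: every member `C₀|x-y|₁^{-3-α}` of `Z3Model` with
`0 < α ≤ 3/2` has marginal-or-faster critical decay `⟨σ₀σ_x⟩_{β_c} ≤ C/‖x‖^{3/2}` (the tree's infrared
bound gives `θ = 3 - α ≥ 3/2`); at `α = 3/2` the exponent is exactly `3/2` — the member of Theorem 1.9 /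
Corollary 1.11, Gaussian at criticality. [cite: Panis2023Triviality, Theorem 1.9 and Corollary 1.11 (p. 8), with §3.6 (p. 16)] -/
theorem hasCriticalDecay_threeHalves_of_le {C₀ α : ℝ} (hC₀ : 0 < C₀) (hα : 0 < α) (hα' : α ≤ 3 / 2) :
    HasCriticalDecay (algebraicCoupling 3 C₀ α) (3 / 2) := by
  have h := hasCriticalDecay_algebraic hC₀ hα (by linarith : α ≠ 2)
  refine h.of_le ?_
  rw [min_eq_left (by linarith : α ≤ 2)]
  linarith

/-- **The strict half of the marginal principle is a theorem**: an MMS-monotone translation-invariant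
`J ≥ 0` on `ℤ³` with critical decay `‖x‖^{-θ}`, `θ > 3/2` ("`η > 1/2`"), has a finite critical bubble and
hence Gaussian critical smearings (generations 2 and 5: `summable_sq_pairCorrelation_of_decay`,
`BubbleTrivialityOnZ3_holds`) — the `d = 3`, `d + 2η > 4` case of Theorem 5.5 in two-point form.
[cite: Panis2023Triviality, Theorem 5.5 (p. 21) and Theorem 12.2 (p. 51)] -/
theorem not_hasNonGaussianSmearingZ3_of_decay_gt {J : Site 3 → Site 3 → ℝ} (hJ : ∀ x y, 0 ≤ J x y)
    (hJt : ∀ a x y, J (x + a) (y + a) = J x y)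
    (hmms : 0 < LongRangeIsing.criticalBeta J → ∀ x y : Site 3, (3 : ℝ) * ‖x‖ ≤ ‖y‖ →
      pairCorrelation J (LongRangeIsing.criticalBeta J) 0 y ≤ pairCorrelation J (LongRangeIsing.criticalBeta J) 0 x)
    {θ : ℝ} (hθ : 3 / 2 < θ) (h : HasCriticalDecay J θ) : ¬ HasNonGaussianSmearingZ3 J :=
  BubbleTrivialityOnZ3_holds J hJ hJt hmms (summable_sq_pairCorrelation_of_decay J hJ hθ h)

/-! ### 2. Lattice consequences of marginal decay `θ = 3/2` -/

section Marginal

variable (J : Site 3 → Site 3 → ℝ)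

/-- The sup norm of the axial point `ne₁` is `n`. [folklore] -/
theorem supNorm_single_zero_natCast (n : ℕ) : Site.supNorm (Pi.single (0 : Fin 3) (n : ℤ) : Site 3) = n := by
  apply le_antisymm
  · refine Site.supNorm_le_iff.2 fun i => ?_
    by_cases hi : i = 0
    · subst hi
      simp
    · rw [Pi.single_eq_of_ne hi]
      simp
  · have h := Site.natAbs_le_supNorm (Pi.single (0 : Fin 3) (n : ℤ) : Site 3) 0
    simpa using h

/-- A decay constant may be taken nonnegative, in the `CE·|x|_∞^{-θ}` form on `Λ_L ∖ Λ_0`. [folklore] -/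
theorem exists_nonneg_of_hasCriticalDecay {θ : ℝ} (h : HasCriticalDecay J θ) :
    ∃ CE : ℝ, 0 ≤ CE ∧ ∀ x : Site 3, x ≠ 0 →
      pairCorrelation J (LongRangeIsing.criticalBeta J) 0 x ≤ CE / ‖x‖ ^ θ := by
  obtain ⟨C, hC⟩ := h
  exact ⟨max C 0, le_max_right _ _, fun x hx => (hC x hx).trans
    (div_le_div_of_nonneg_right (le_max_left C 0) (Real.rpow_nonneg (norm_nonneg x) θ))⟩

/-- **Marginal decay gives `χ_L(β_c) ≤ C L^{3/2}`** (`boxSusceptibility_le_of_irb` at `η = 1/2`).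
[cite: Panis2023Triviality, proof of Theorem 5.5 ("χ_L(β) ≤ C_4 L^{2-η}"), p. 22] -/
theorem boxSusceptibility_le_of_marginalDecay (hJ : ∀ x y, 0 ≤ J x y) (h : HasCriticalDecay J (3 / 2)) :
    ∃ C : ℝ, 0 < C ∧ ∀ L : ℕ, 1 ≤ L →
      boxSusceptibility J (LongRangeIsing.criticalBeta J) L ≤ C * (L : ℝ) ^ ((3 : ℝ) / 2) := by
  obtain ⟨CE, hCE, hE⟩ := exists_nonneg_of_hasCriticalDecay J h
  have hβ : 0 ≤ LongRangeIsing.criticalBeta J := criticalBeta_nonneg J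
  refine ⟨1 + 26 * CE * (1 + 1 / (2 - 1 / 2)), by positivity, fun L hL => ?_⟩
  have hE' : ∀ x : Site 3, x ≠ 0 →
      pairCorrelation J (LongRangeIsing.criticalBeta J) 0 x ≤ CE / ‖x‖ ^ (1 + (1 / 2 : ℝ)) := by
    intro x hx
    rw [show (1 : ℝ) + 1 / 2 = 3 / 2 by norm_num]
    exact hE x hx
  have h1 := boxSusceptibility_le_of_irb J (LongRangeIsing.criticalBeta J) hβ hJ
    (by norm_num : (1 / 2 : ℝ) < 2) hCE hE' hL
  have h2 : (L : ℝ) ^ ((2 : ℝ) - 1 / 2) = (L : ℝ) ^ ((3 : ℝ) / 2) := by norm_num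
  rw [h2] at h1
  exact h1

/-- **On the marginal line `χ_L(β_c)²/L³` is bounded** — neither `→ 0` (the hypothesis of
`SusceptibilityTrivialityOnZ3`) nor unbounded: the generation-4 criterion does not decide the line.
[cite: AizenmanCDM2020, §10.1 eq. (10.2), p. 31] -/
theorem boxSusceptibility_sq_div_cube_le_of_marginalDecay (hJ : ∀ x y, 0 ≤ J x y)
    (h : HasCriticalDecay J (3 / 2)) :
    ∃ C : ℝ, ∀ L : ℕ, 1 ≤ L →
      boxSusceptibility J (LongRangeIsing.criticalBeta J) L ^ 2 / (L : ℝ) ^ 3 ≤ C := by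
  obtain ⟨C, hC, hχ⟩ := boxSusceptibility_le_of_marginalDecay J hJ h
  have hβ : 0 ≤ LongRangeIsing.criticalBeta J := criticalBeta_nonneg J
  refine ⟨C ^ 2, fun L hL => ?_⟩
  have hL0 : (0 : ℝ) < L := by exact_mod_cast hL
  have hχ0 : 0 ≤ boxSusceptibility J (LongRangeIsing.criticalBeta J) L :=
    boxSusceptibility_nonneg J _ hβ hJ L
  have h1 := hχ L hL
  have hsq : boxSusceptibility J (LongRangeIsing.criticalBeta J) L ^ 2 ≤ (C * (L : ℝ) ^ ((3 : ℝ) / 2)) ^ 2 :=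
    pow_le_pow_left₀ hχ0 h1 2
  have hpow : ((L : ℝ) ^ ((3 : ℝ) / 2)) ^ 2 = (L : ℝ) ^ 3 := by
    rw [← Real.rpow_natCast ((L : ℝ) ^ ((3 : ℝ) / 2)) 2, ← Real.rpow_mul hL0.le]
    norm_num
  rw [div_le_iff₀ (by positivity), ← hpow, ← mul_pow]
  exact hsq

/-- **On the marginal line the bubble grows at most logarithmically**:
`∑_{x∈Λ_n}⟨σ₀σ_x⟩²_{β_c} ≤ C(1 + log n)` (`n ≥ 1`; spheres of size `≤ 26k²` and the harmonic sum) —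
compatible with `B(β_c) = ∞` and with "`B_n(β_c) ≥ c√(log n)` if `d = 3`".
[cite: DuminilCopinPanis2025LowerBounds, Theorem 1.8 and Remark 1.9, p. 7] -/
theorem bubble_le_log_of_marginalDecay (hJ : ∀ x y, 0 ≤ J x y) (h : HasCriticalDecay J (3 / 2)) :
    ∃ C : ℝ, 0 < C ∧ ∀ n : ℕ, 1 ≤ n →
      ∑ x ∈ box 3 n, pairCorrelation J (LongRangeIsing.criticalBeta J) 0 x ^ 2 ≤ C * (1 + Real.log n) := by
  obtain ⟨CE, hCE, hE⟩ := exists_nonneg_of_hasCriticalDecay J h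
  set βc := LongRangeIsing.criticalBeta J with hβc
  have hβ : 0 ≤ βc := criticalBeta_nonneg J
  refine ⟨1 + 26 * CE ^ 2, by positivity, fun n hn => ?_⟩
  have hlog : 0 ≤ Real.log n := Real.log_nonneg (by exact_mod_cast hn)
  -- the term `x = 0`
  have hsplit : ∑ x ∈ box 3 n, pairCorrelation J βc 0 x ^ 2 =
      ∑ x ∈ box 3 n \ box 3 0, pairCorrelation J βc 0 x ^ 2 + ∑ x ∈ box 3 0, pairCorrelation J βc 0 x ^ 2 := by
    rw [Finset.sum_sdiff (box_mono 3 (Nat.zero_le n))]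
  have hzero : ∑ x ∈ box 3 0, pairCorrelation J βc 0 x ^ 2 ≤ 1 := by
    calc ∑ x ∈ box 3 0, pairCorrelation J βc 0 x ^ 2 ≤ ∑ _x ∈ box 3 0, (1 : ℝ) :=
          Finset.sum_le_sum fun x _ => (sq_le_one_iff_abs_le_one _).2 (abs_pairCorrelation_le_one J βc hβ hJ 0 x)
      _ = 1 := by rw [Finset.sum_const, card_box, nsmul_eq_mul, mul_one]; norm_num
  -- the other terms: `⟨σ₀σ_x⟩² ≤ CE² |x|_∞^{-3}`
  have hterm : ∀ x ∈ box 3 n \ box 3 0,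
      pairCorrelation J βc 0 x ^ 2 ≤ CE ^ 2 * ((Site.supNorm x : ℝ)) ^ (-(3 : ℝ)) := by
    intro x hx
    rw [Finset.mem_sdiff, mem_box_iff_supNorm_le, mem_box_iff_supNorm_le] at hx
    have hpos : 0 < Site.supNorm x := by omega
    have hx0 : x ≠ 0 := fun h0 => by rw [h0, Site.supNorm_eq_zero_iff.2 rfl] at hpos; exact lt_irrefl 0 hpos
    have hn0 : (0 : ℝ) < Site.supNorm x := by exact_mod_cast hpos
    have h1 := hE x hx0
    rw [Site.norm_eq_supNorm] at h1
    have h0 : 0 ≤ pairCorrelation J βc 0 x := pairCorrelation_nonneg J βc hβ hJ 0 x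
    have h2 : pairCorrelation J βc 0 x ^ 2 ≤ (CE / (Site.supNorm x : ℝ) ^ ((3 : ℝ) / 2)) ^ 2 :=
      pow_le_pow_left₀ h0 h1 2
    refine h2.trans (le_of_eq ?_)
    rw [div_pow, ← Real.rpow_natCast ((Site.supNorm x : ℝ) ^ ((3 : ℝ) / 2)) 2, ← Real.rpow_mul hn0.le,
      Real.rpow_neg hn0.le, div_eq_mul_inv]
    norm_num
  -- radial summation and the harmonic sum
  have hradial : ∑ x ∈ box 3 n \ box 3 0, ((Site.supNorm x : ℝ)) ^ (-(3 : ℝ)) ≤ 26 * (1 + Real.log n) := by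
    rw [sum_box_sdiff_eq_sum_sphere (fun k => ((k : ℝ)) ^ (-(3 : ℝ))) 0 n]
    have hIoc : Finset.Ioc 0 n = Finset.Icc 1 n := by
      ext k
      simp only [Finset.mem_Ioc, Finset.mem_Icc]
      omega
    rw [hIoc]
    have hk : ∀ k ∈ Finset.Icc 1 n, (#(sphere 3 k) : ℝ) * ((k : ℝ)) ^ (-(3 : ℝ)) ≤ 26 * ((k : ℝ))⁻¹ := by
      intro k hk
      rw [Finset.mem_Icc] at hk
      have hk0 : (0 : ℝ) < k := by exact_mod_cast hk.1
      calc (#(sphere 3 k) : ℝ) * ((k : ℝ)) ^ (-(3 : ℝ)) ≤ 26 * (k : ℝ) ^ 2 * ((k : ℝ)) ^ (-(3 : ℝ)) :=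
            mul_le_mul_of_nonneg_right (card_sphere_three_le hk.1) (Real.rpow_nonneg hk0.le _)
        _ = 26 * ((k : ℝ)) ^ ((2 : ℝ) + (-(3 : ℝ))) := by
            rw [Real.rpow_add hk0, mul_assoc]
            norm_num
        _ = 26 * ((k : ℝ))⁻¹ := by
            rw [show (2 : ℝ) + -(3 : ℝ) = -1 by norm_num, Real.rpow_neg_one]
    have hharm : ∑ k ∈ Finset.Icc 1 n, ((k : ℝ))⁻¹ ≤ 1 + Real.log n := by
      have h1 := harmonic_le_one_add_log n
      rw [harmonic_eq_sum_Icc] at h1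
      push_cast at h1
      exact h1
    calc ∑ k ∈ Finset.Icc 1 n, (#(sphere 3 k) : ℝ) * ((k : ℝ)) ^ (-(3 : ℝ))
        ≤ ∑ k ∈ Finset.Icc 1 n, 26 * ((k : ℝ))⁻¹ := Finset.sum_le_sum hk
      _ = 26 * ∑ k ∈ Finset.Icc 1 n, ((k : ℝ))⁻¹ := by rw [Finset.mul_sum]
      _ ≤ 26 * (1 + Real.log n) := by gcongr
  calc ∑ x ∈ box 3 n, pairCorrelation J βc 0 x ^ 2
      = ∑ x ∈ box 3 n \ box 3 0, pairCorrelation J βc 0 x ^ 2 + ∑ x ∈ box 3 0, pairCorrelation J βc 0 x ^ 2 := hsplit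
    _ ≤ ∑ x ∈ box 3 n \ box 3 0, CE ^ 2 * ((Site.supNorm x : ℝ)) ^ (-(3 : ℝ)) + 1 := by
        linarith [Finset.sum_le_sum hterm, hzero]
    _ = CE ^ 2 * ∑ x ∈ box 3 n \ box 3 0, ((Site.supNorm x : ℝ)) ^ (-(3 : ℝ)) + 1 := by rw [Finset.mul_sum]
    _ ≤ CE ^ 2 * (26 * (1 + Real.log n)) + 1 := by
        linarith [mul_le_mul_of_nonneg_left hradial (sq_nonneg CE)]
    _ ≤ CE ^ 2 * (26 * (1 + Real.log n)) + (1 + Real.log n) := by linarith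
    _ = (1 + 26 * CE ^ 2) * (1 + Real.log n) := by ring

/-- **On the marginal line the denominator of Duminil-Copin–Panis's Theorem 1.3 is `O(n^{3/2})`**:
`χ_{4n}(β_c) + n∑_{1≤k≤2n} k⟨σ₀σ_{ke₁}⟩_{β_c} ≤ D n^{3/2}` (`n ≥ 1`): `χ_{4n} ≤ C(4n)^{3/2}` and
`∑_{k≤2n} k·k^{-3/2} ≤ (2n)^{1/2}/(1/2)`. [cite: DuminilCopinPanis2025LowerBounds, Theorem 1.3, p. 5] -/
theorem dcpDenominator_le_of_marginalDecay (hJ : ∀ x y, 0 ≤ J x y) (h : HasCriticalDecay J (3 / 2)) :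
    ∃ D : ℝ, 0 < D ∧ ∀ n : ℕ, 1 ≤ n →
      boxSusceptibility J (LongRangeIsing.criticalBeta J) (4 * n) +
        n * ∑ k ∈ Finset.Icc 1 (2 * n), (k : ℝ) *
          pairCorrelation J (LongRangeIsing.criticalBeta J) 0 (Pi.single 0 (k : ℤ)) ≤ D * (n : ℝ) ^ ((3 : ℝ) / 2) := by
  obtain ⟨C, hC, hχ⟩ := boxSusceptibility_le_of_marginalDecay J hJ h
  obtain ⟨CE, hCE, hE⟩ := exists_nonneg_of_hasCriticalDecay J h
  set βc := LongRangeIsing.criticalBeta J with hβc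
  refine ⟨16 * C + 4 * CE, by positivity, fun n hn => ?_⟩
  have hn0 : (0 : ℝ) < n := by exact_mod_cast hn
  have hnp : 0 < (n : ℝ) ^ ((3 : ℝ) / 2) := Real.rpow_pos_of_pos hn0 _
  -- first term
  have h4n : 1 ≤ 4 * n := by omega
  have hfirst : boxSusceptibility J βc (4 * n) ≤ 16 * C * (n : ℝ) ^ ((3 : ℝ) / 2) := by
    have h1 := hχ (4 * n) h4n
    have h2 : (((4 * n : ℕ)) : ℝ) ^ ((3 : ℝ) / 2) = (4 : ℝ) ^ ((3 : ℝ) / 2) * (n : ℝ) ^ ((3 : ℝ) / 2) := by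
      push_cast
      exact Real.mul_rpow (by norm_num) hn0.le
    have h3 : (4 : ℝ) ^ ((3 : ℝ) / 2) ≤ 16 := by
      calc (4 : ℝ) ^ ((3 : ℝ) / 2) ≤ (4 : ℝ) ^ (2 : ℝ) :=
            Real.rpow_le_rpow_of_exponent_le (by norm_num) (by norm_num)
        _ = 16 := by norm_num
    calc boxSusceptibility J βc (4 * n) ≤ C * ((((4 * n : ℕ)) : ℝ) ^ ((3 : ℝ) / 2)) := h1
      _ = C * (4 : ℝ) ^ ((3 : ℝ) / 2) * (n : ℝ) ^ ((3 : ℝ) / 2) := by rw [h2]; ring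
      _ ≤ C * 16 * (n : ℝ) ^ ((3 : ℝ) / 2) := by gcongr
      _ = 16 * C * (n : ℝ) ^ ((3 : ℝ) / 2) := by ring
  -- second term
  have hterm : ∀ k ∈ Finset.Icc 1 (2 * n),
      (k : ℝ) * pairCorrelation J βc 0 (Pi.single 0 (k : ℤ)) ≤ CE * (k : ℝ) ^ (-(1 / 2 : ℝ)) := by
    intro k hk
    rw [Finset.mem_Icc] at hk
    have hk0 : (0 : ℝ) < k := by exact_mod_cast hk.1
    have hx0 : (Pi.single 0 (k : ℤ) : Site 3) ≠ 0 := by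
      intro h0
      have := congr_fun h0 0
      simp only [Pi.single_eq_same, Pi.zero_apply, Nat.cast_eq_zero] at this
      omega
    have h1 := hE _ hx0
    rw [Site.norm_eq_supNorm, supNorm_single_zero_natCast] at h1
    calc (k : ℝ) * pairCorrelation J βc 0 (Pi.single 0 (k : ℤ)) ≤ (k : ℝ) * (CE / (k : ℝ) ^ ((3 : ℝ) / 2)) :=
          mul_le_mul_of_nonneg_left h1 hk0.le
      _ = CE * ((k : ℝ) ^ (1 : ℝ) * ((k : ℝ) ^ ((3 : ℝ) / 2))⁻¹) := by rw [Real.rpow_one]; ring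
      _ = CE * (k : ℝ) ^ (-(1 / 2 : ℝ)) := by
          rw [← Real.rpow_neg hk0.le, ← Real.rpow_add hk0]
          norm_num
  have h2n : 1 ≤ 2 * n := by omega
  have hsum : ∑ k ∈ Finset.Icc 1 (2 * n), (k : ℝ) * pairCorrelation J βc 0 (Pi.single 0 (k : ℤ)) ≤
      4 * CE * (n : ℝ) ^ ((1 : ℝ) / 2) := by
    have h1 := sum_Icc_rpow_neg_le (s := (1 / 2 : ℝ)) (by norm_num) (by norm_num) h2n
    have h2 : (((2 * n : ℕ)) : ℝ) ^ (1 - (1 / 2 : ℝ)) ≤ 2 * (n : ℝ) ^ ((1 : ℝ) / 2) := by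
      rw [show (1 : ℝ) - 1 / 2 = 1 / 2 by norm_num]
      push_cast
      rw [Real.mul_rpow (by norm_num) hn0.le]
      have h3 : (2 : ℝ) ^ ((1 : ℝ) / 2) ≤ 2 := by
        calc (2 : ℝ) ^ ((1 : ℝ) / 2) ≤ (2 : ℝ) ^ (1 : ℝ) :=
              Real.rpow_le_rpow_of_exponent_le (by norm_num) (by norm_num)
          _ = 2 := Real.rpow_one 2
      have h4 : 0 ≤ (n : ℝ) ^ ((1 : ℝ) / 2) := Real.rpow_nonneg hn0.le _
      nlinarith
    calc ∑ k ∈ Finset.Icc 1 (2 * n), (k : ℝ) * pairCorrelation J βc 0 (Pi.single 0 (k : ℤ))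
        ≤ ∑ k ∈ Finset.Icc 1 (2 * n), CE * (k : ℝ) ^ (-(1 / 2 : ℝ)) := Finset.sum_le_sum hterm
      _ = CE * ∑ k ∈ Finset.Icc 1 (2 * n), (k : ℝ) ^ (-(1 / 2 : ℝ)) := by rw [Finset.mul_sum]
      _ ≤ CE * ((((2 * n : ℕ)) : ℝ) ^ (1 - (1 / 2 : ℝ)) / (1 - 1 / 2)) := mul_le_mul_of_nonneg_left h1 hCE
      _ = 2 * CE * (((2 * n : ℕ)) : ℝ) ^ (1 - (1 / 2 : ℝ)) := by ring
      _ ≤ 2 * CE * (2 * (n : ℝ) ^ ((1 : ℝ) / 2)) := by gcongr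
      _ = 4 * CE * (n : ℝ) ^ ((1 : ℝ) / 2) := by ring
  have hsecond : (n : ℝ) * ∑ k ∈ Finset.Icc 1 (2 * n), (k : ℝ) * pairCorrelation J βc 0 (Pi.single 0 (k : ℤ)) ≤
      4 * CE * (n : ℝ) ^ ((3 : ℝ) / 2) := by
    calc (n : ℝ) * ∑ k ∈ Finset.Icc 1 (2 * n), (k : ℝ) * pairCorrelation J βc 0 (Pi.single 0 (k : ℤ))
        ≤ (n : ℝ) * (4 * CE * (n : ℝ) ^ ((1 : ℝ) / 2)) := mul_le_mul_of_nonneg_left hsum hn0.le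
      _ = 4 * CE * ((n : ℝ) ^ (1 : ℝ) * (n : ℝ) ^ ((1 : ℝ) / 2)) := by rw [Real.rpow_one]; ring
      _ = 4 * CE * (n : ℝ) ^ ((3 : ℝ) / 2) := by
          rw [← Real.rpow_add hn0]
          norm_num
  calc boxSusceptibility J βc (4 * n) +
        (n : ℝ) * ∑ k ∈ Finset.Icc 1 (2 * n), (k : ℝ) * pairCorrelation J βc 0 (Pi.single 0 (k : ℤ))
      ≤ 16 * C * (n : ℝ) ^ ((3 : ℝ) / 2) + 4 * CE * (n : ℝ) ^ ((3 : ℝ) / 2) := add_le_add hfirst hsecond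
    _ = (16 * C + 4 * CE) * (n : ℝ) ^ ((3 : ℝ) / 2) := by ring

/-- **The marginal profile is a fixed point of the Duminil-Copin–Panis inequality**: if the critical
two-point function of `J ≥ 0` on `ℤ³` has marginal decay `⟨σ₀σ_x⟩_{β_c} ≤ C/‖x‖^{3/2}` and satisfies
the inequality of Theorem 1.3 at `β_c` (here a hypothesis, in the shape used by generation 4's
`frequently_boxSusceptibility_sq_ge_of_dcp`; printed for the nearest-neighbour model with `L(β_c) = ∞`),
then the axial two-point function is TWO-SIDED marginal, `c/n^{3/2} ≤ ⟨σ₀σ_{ne₁}⟩_{β_c} ≤ C/n^{3/2}` for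
large `n` — Theorem 1.3 returns the profile and cannot exclude it; "`η ≤ 1/2`" (Theorem 1.5) is all it
gives, the strict `η < 1/2` is beyond it. [cite: DuminilCopinPanis2025LowerBounds, Theorems 1.3 and 1.5, pp. 5–6] -/
theorem marginalProfile_of_dcp (hJ : ∀ x y, 0 ≤ J x y) (h : HasCriticalDecay J (3 / 2))
    {c₁ : ℝ} (hc₁ : 0 < c₁) {N₁ : ℕ}
    (hdcp : ∀ n : ℕ, N₁ ≤ n → c₁ ≤ pairCorrelation J (LongRangeIsing.criticalBeta J) 0 (Pi.single 0 (n : ℤ)) *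
      (boxSusceptibility J (LongRangeIsing.criticalBeta J) (4 * n) +
        n * ∑ k ∈ Finset.Icc 1 (2 * n), (k : ℝ) *
          pairCorrelation J (LongRangeIsing.criticalBeta J) 0 (Pi.single 0 (k : ℤ)))) :
    ∃ c C : ℝ, 0 < c ∧ ∀ n : ℕ, max N₁ 1 ≤ n →
      c / (n : ℝ) ^ ((3 : ℝ) / 2) ≤ pairCorrelation J (LongRangeIsing.criticalBeta J) 0 (Pi.single 0 (n : ℤ)) ∧
        pairCorrelation J (LongRangeIsing.criticalBeta J) 0 (Pi.single 0 (n : ℤ)) ≤ C / (n : ℝ) ^ ((3 : ℝ) / 2) := by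
  obtain ⟨D, hD, hden⟩ := dcpDenominator_le_of_marginalDecay J hJ h
  obtain ⟨CE, hCE, hE⟩ := exists_nonneg_of_hasCriticalDecay J h
  set βc := LongRangeIsing.criticalBeta J with hβc
  have hβ : 0 ≤ βc := criticalBeta_nonneg J
  refine ⟨c₁ / D, CE, by positivity, fun n hn => ?_⟩
  have hN : N₁ ≤ n := le_trans (le_max_left _ _) hn
  have hn1 : 1 ≤ n := le_trans (le_max_right _ _) hn
  have hn0 : (0 : ℝ) < n := by exact_mod_cast hn1
  have hnp : 0 < (n : ℝ) ^ ((3 : ℝ) / 2) := Real.rpow_pos_of_pos hn0 _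
  set s := pairCorrelation J βc 0 (Pi.single 0 (n : ℤ)) with hs
  have hs0 : 0 ≤ s := pairCorrelation_nonneg J βc hβ hJ 0 _
  constructor
  · -- lower bound from Theorem 1.3 and the `O(n^{3/2})` denominator
    have h1 := hdcp n hN
    have h2 := hden n hn1
    have h3 : c₁ ≤ s * (D * (n : ℝ) ^ ((3 : ℝ) / 2)) := h1.trans (mul_le_mul_of_nonneg_left h2 hs0)
    rw [div_div, div_le_iff₀ (by positivity)]
    linarith
  · -- upper bound: the marginal decay on the axis
    have hx0 : (Pi.single 0 (n : ℤ) : Site 3) ≠ 0 := by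
      intro h0
      have := congr_fun h0 0
      simp only [Pi.single_eq_same, Pi.zero_apply, Nat.cast_eq_zero] at this
      omega
    have h1 := hE _ hx0
    rwa [Site.norm_eq_supNorm, supNorm_single_zero_natCast] at h1

end Marginal

end LongRangeIsing

open LongRangeIsing

/-! ### 3. The skeleton: against the improved bound, non-triviality needs the STRICT `η < 1/2` -/

/-- **If the marginal principle holds on `ℤ³`, a non-Gaussian member of `Z3Model` has no marginal decay.**
The principle — "an MMS-monotone translation-invariant `J ≥ 0` with `⟨σ₀σ_x⟩_{β_c} = O(|x|^{-3/2})` has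
Gaussian critical smearings" — is the `d = 3` reading of the improved tree diagram bound (PROVED by Panis for
the coupling `C₀|x-y|₁^{-9/2}`, Theorem 7.1 / Corollary 7.3, and expected by him "under more general
assumptions", footnote 7, p. 34); it enters here as an INLINE HYPOTHESIS, not as a fact of the tree. Granting
it, a non-Gaussian critical smearing of a member (the nearest-neighbour model included, MMS2 for it a
hypothesis as in generations 2–5) forces `¬ HasCriticalDecay J (3/2)`: `limsup_x ‖x‖^{3/2}⟨σ₀σ_x⟩_{β_c} = ∞`,
"`η < 1/2`" in the strict, lim-sup sense — one notch beyond the printed `η ≤ 1/2`.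
[cite: Panis2023Triviality, §7 (Theorem 7.1, footnote 7), p. 34] [cite: DuminilCopinPanis2025LowerBounds, Theorem 1.5, p. 6] -/
theorem not_hasCriticalDecay_threeHalves_of_marginalPrinciple
    (hM : ∀ J : Site 3 → Site 3 → ℝ, (∀ x y, 0 ≤ J x y) → (∀ a x y, J (x + a) (y + a) = J x y) →
      (0 < LongRangeIsing.criticalBeta J → ∀ x y : Site 3, (3 : ℝ) * ‖x‖ ≤ ‖y‖ →
        pairCorrelation J (LongRangeIsing.criticalBeta J) 0 y ≤ pairCorrelation J (LongRangeIsing.criticalBeta J) 0 x) →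
      HasCriticalDecay J (3 / 2) → ¬ HasNonGaussianSmearingZ3 J)
    (m : Z3Model)
    (hmms : 0 < LongRangeIsing.criticalBeta m.coupling → ∀ x y : Site 3, (3 : ℝ) * ‖x‖ ≤ ‖y‖ →
      pairCorrelation m.coupling (LongRangeIsing.criticalBeta m.coupling) 0 y ≤
        pairCorrelation m.coupling (LongRangeIsing.criticalBeta m.coupling) 0 x)
    (hng : HasNonGaussianSmearingZ3 m.coupling) : ¬ HasCriticalDecay m.coupling (3 / 2) :=
  fun hdec => hM m.coupling m.coupling_nonneg m.coupling_add hmms hdec hng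

/-- **The strict half of the principle IS interaction-uniform on `Z3Model`** (MMS2 granted): for every
member, critical decay `‖x‖^{-θ}` with `θ > 3/2` implies Gaussian critical smearings — exactly as "finite
bubble ⟹ Gaussian" (generation 2) and "`χ_L = o(L^{3/2})` ⟹ Gaussian" (generation 4); the whole
nearest-neighbour specificity of a proof of clause (iii) is pushed into the window `θ ≤ 3/2`, and, granting
the marginal principle, into `θ < 3/2` in the lim-sup sense. [cite: Panis2023Triviality, Theorem 5.5 (p. 21) and Theorem 12.2 (p. 51)] -/
theorem interactionUniformZ3_marginalPrinciple_strict :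
    InteractionUniformZ3 fun m =>
      (0 < LongRangeIsing.criticalBeta m.coupling → ∀ x y : Site 3, (3 : ℝ) * ‖x‖ ≤ ‖y‖ →
        pairCorrelation m.coupling (LongRangeIsing.criticalBeta m.coupling) 0 y ≤
          pairCorrelation m.coupling (LongRangeIsing.criticalBeta m.coupling) 0 x) →
      ∀ θ : ℝ, 3 / 2 < θ → HasCriticalDecay m.coupling θ → ¬ HasNonGaussianSmearingZ3 m.coupling :=
  fun m hmms _ hθ hdec => not_hasNonGaussianSmearingZ3_of_decay_gt m.coupling_nonneg m.coupling_add hmms hθ hdec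

end Literature.Barriers.CriticalPhenomena

end
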